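import Summits.BirchSwinnertonDyer.Rank1Residual.Additive.RamifiedOrdinaryLineTransport
import Summits.BirchSwinnertonDyer.Rank1Residual.Additive.GordRankZeroChiBranch
import Summits.BirchSwinnertonDyer.Rank1Residual.X2.GreenbergVatsalReductionDatumCard
import Literature.NumberTheory.GaloisRepresentations.KummerQuadraticCharacterInertia
import Literature.NumberTheory.GaloisRepresentations.RatPlaceTwoProofs
import HarnessLib

/-!
# TB-ROL FILE B: the RAMIFIED ORDINARY LINE of an X4♯(G-ord) / X3♯(G-ord) row EXISTS IN THE KERNEL —
# `IsRamifiedOrdinaryLine W p L` DISCHARGED, unconditionally, from Greenberg's good-ordinary datum of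
# the twist and the quadratic twisting isomorphism (team n1011, seat p10 gen 3, OWNERS optional row
# TB-ROL; lead GEN 6 R5-32; n1011-lit GEN 4 verdict "NOT-A-FACT: the line is already a tree theorem")

HONEST FRAMING (cell `b2b-bsdres`, run/shared/lean/b2b/bsd-rank1-residual/, verbatim in every
file): the goal of the cell is to DELETE the COMBINATION-SHAPED residual classes of the
Birch–Swinnerton-Dyer formula for ALL analytic-rank `≤ 1` elliptic curves over `ℚ` — "full BSD
formula for every rank `≤ 1` curve in class `C`" assembled STRICTLY from published theorems — so
that the rank-`≤ 1` remainder becomes exactly the CONSTRUCTION-SHAPED classes, which are TYPED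
(missing-input `Prop`s), NOT attempted. This is not "finishing BSD". Team n1011 (N10/N11: X4 ∧
`p = 3`): research route on the CONSTRUCTION-SHAPED class X4; prove what is provable now; no claim
beyond stated classes; census output = EVIDENCE / conjecture items, never a Literature fact;
X4♯(G-ord) stays CONSTRUCTION-SHAPED; RESIDUAL-MAP marks UNCHANGED; nothing is booked by this file.
Theorems only: NO definition, NO named fact, NO conjecture node; no hypothesis of any consumer is
dropped — one per-pair BINDER of Route G's EPW discharge (the two `IsRamifiedOrdinaryLine` data of
`ClassX4Gord.mainConjecture_of_katoHalf_of_coeffCert_of_epw`, cc-typer-1's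
`congruentLambdaShift_of_epw`) becomes a THEOREM on the class.

## What and why

EPW 2006 §3.1 attaches to a `p`-ordinary `p`-stabilised newform `f` the filtration
`0 → A'_{f,i} → A_{f,i} → A''_{f,i} → 0`; for the member `f̃` of an elliptic curve `E/ℚ` with ADDITIVE
potentially good ORDINARY reduction at the odd prime `p` and semistability defect `e = 2`
(X4♯(G-ord) ∩ `I₀*`, resp. X3♯(G-ord) ∩ `I₀*`) the line `A'_{f̃,a} ⊂ E[p^∞]` is what the tree calls
`IsRamifiedOrdinaryLine W p L` (cc-typer-1, `NearlyOrdinaryAlgebraicTransfer.lean`): `L.plus`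
divisible, `≠ ⊤`, `≠ ⊥`, `D_v`-stable, inertia acting on `E[p^∞]/L.plus` through a finite (`n ≥ 1`)
NON-TRIVIAL quotient. Such an `E` is `V ⊗ χ_{p*}` with `V` GOOD ORDINARY at `p` (the cell's twist
model: `C • V^{(p*)} = W`, `GoodOrd V p`, tree `ClassX4Gord.exists_goodOrd_pStar_twist_model`), and
the line is Greenberg's `C_v(V) = ker(V[p^∞] → Ṽ(k̄_v)) ≅ ℚ_p/ℤ_p` (LNM 1716 §2 pp. 62–63: "`C_v` is
`G_{F_v}`-invariant and `E[p^∞]/C_v` is the maximal unramified quotient of `E[p^∞]`"; p. 69: on `C_v`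
"`ψ` and `χ` become equal after restriction to the inertia subgroup") carried to `E[p^∞]` by the
twisting isomorphism `t : V(ℚ̄) ≃ E(ℚ̄)`, `t(σP) = χ_{p*}(σ) σ t(P)` (Silverman *AEC* X.5 Cor. 5.4),
under which the UNRAMIFIED quotient `Ṽ[p^∞]` becomes ramified through the quadratic character
`χ_{p*}|_{I_p} = ω^{(p−1)/2}` — EPW's branch `i = a = (p−1)/2`. Everything needed is a tree THEOREM
(n1011-lit GEN 4 tree map, 2026-08-21): `reductionDatum` + `reductionDatum_htriv` (X2 gen 9),
`natCard_reductionDatum_plus_inf_torsionBy` (X2 gen 19), `localRed_ordinary_filtration` (iii)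
(divisibility of `ker red_v`), the signed twisting isomorphism, and the Kummer inertia element
`σ√p* = −√p*` (`exists_mem_inertia_smul_geomSqrt_eq_neg`, `ord_v(p*) = 1`, `p` odd). So NO cited
fact is minted (debt 0) and the discharge is UNCONDITIONAL:

* §1 (the good-ordinary datum is an ordinary LINE) `reductionDatum_divisible`,
  `reductionDatum_plus_ne_top`, `reductionDatum_plus_ne_bot` — at a good ORDINARY `v ∋ p` of a
  globally minimal `V/ℚ`, `C_v` is `p`-divisible, proper (the ordinary point reduces non-trivially)
  and non-zero (`#C_v[p] = p`).
* §2 (the ramified-`χ` inertia witness) `intValuation_pStar`, `exists_mem_absInertia_smul_geomSqrt_eq_neg`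
  — `ord_v(p*) = 1`, so some LOCAL inertia element `σ ∈ I(ℚ̄_v/ℚ_v)` has `res(σ)√d = −√d` for every
  `d ∈ ℤ` with `ord_v d = 1` (`p` odd).
* §3 (assembly) **`isRamifiedOrdinaryLine_of_transport_reductionDatum`** — for ANY
  sign-equivariant `e : V[p^∞] ≃+ W[p^∞]` anti-equivariant where `σ√d = −√d` (`ord_v d = 1`) and ANY
  local datum `L` of `W` with `m ∈ L.plus ↔ e⁻¹m ∈ C_v(V)` (a transport of Greenberg's datum along
  `e`; one exists, FILE A `exists_localDatum_transport`), `L` IS a ramified ordinary line of `W`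
  (explicit form: consumers holding their own `e` characterise the line without choice);
  **`exists_isRamifiedOrdinaryLine_of_goodOrd_model_twist`** / `…_pStar_twist` (existence on any
  `ℚ`-model `W = C • V^{(d)}`, `V` good ordinary, `ord_v d = 1`; `d = p*`);
  **`ClassX4Gord.exists_isRamifiedOrdinaryLine`**, **`ClassX3Gord.exists_isRamifiedOrdinaryLine`** —
  on X4♯(G-ord) ∩ `I₀*` (any odd `p`, incl. `p = 3`) and X3♯(G-ord) ∩ `I₀*` (odd `p`), at the place
  `v ∋ p`: `∃ L, IsRamifiedOrdinaryLine W p L`. The per-pair EPW binders "ramified ordinary lines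
  `L`, `L₁`" of Route G FILE 4 / (M)-FILE 3 are thereby theorems for (G-ord) rows; what STAYS per pair
  is the line-RESPECTING `E[p] ≅ E₁[p]` (same `p`-stabilisation) and `Σ₀` — untouched here.
Binder honesty: no named fact enters; `ClassX4Gord W p` / `ClassX3Gord W p`, `e_E(p) = 2` are the
class binders of record; the (M) rows (potentially multiplicative, Tate-curve line) are NOT covered by
this file (their line is the Tate datum, `GreenbergVatsalTateDatumCofree`, a sibling task).

References: Emerton–Pollack–Weston, Invent. Math. 163 (2006) §3.1 (arXiv math/0404484 p. 17)
[EmertonPollackWeston2006]; R. Greenberg, in LNM 1716 (1999) §1 p. 62, §2 pp. 62–63, 69–70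
[GreenbergLNM1716]; Greenberg–Vatsal, Invent. Math. 142 (2000) §2 p. 14 [GreenbergVatsal2000];
J. H. Silverman, *AEC* 2nd ed. VII.2.1, X.5 Cor. 5.4 [SilvermanAEC2009]; S. Lang, *Fundamentals of
Diophantine Geometry* Ch. 6 Prop. 1.3 [Lang1983]; n1011-lit GEN 4 (HOME/INBOX.md 2026-08-21T09:10Z,
LIT-INPUTS-P3 sheet v20 §28: page-check of Greenberg pp. 63, 69).
-/

set_option autoImplicit false

noncomputable section

open scoped Classical NumberField

open NumberField IsDedekindDomain Field WeierstrassCurve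
  Literature.NumberTheory.GaloisRepresentations
  Literature.NumberTheory.EllipticCurves
  Literature.NumberTheory.EllipticCurves.Rank1Residual
  Literature.NumberTheory.EllipticCurves.GreenbergSelmer
  Literature.NumberTheory.EllipticCurves.EmertonPollackWeston2006
  IsDedekindDomain.HeightOneSpectrum
  Summit.BirchSwinnertonDyer.Rank1Residual.X2
  Summit.BirchSwinnertonDyer.Rank1Residual.X2.GreenbergVatsalReductionDatum
open WeierstrassCurve (minimalDiscriminantInt integralModelInt)

namespace Summit.BirchSwinnertonDyer.Rank1Residual.Additive

/-! ### §1 Greenberg's good-ordinary datum `C_v` is an ordinary LINE: divisible, proper, non-zero -/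

section Datum

variable (V : WeierstrassCurve ℚ) [V.IsGloballyMinimal] [V.IsElliptic] (p : ℕ) [hp : Fact p.Prime]
  {v : HeightOneSpectrum (𝓞 ℚ)}

/-- **`C_v` is `p`-DIVISIBLE at a good ordinary prime** (`C_v ≅ ℚ_p/ℤ_p`, Greenberg LNM 1716 §2
p. 63: "It is easy to see that `C_v ≅ ℚ_p/ℤ_p`. (In fact, `C_v = ℱ(𝔪̄)[p^∞]` …)"): for `m ∈ C_v` of
order `p^k`, the tree's ordinary filtration (`localRed_ordinary_filtration` (iii): `ker red_v` is
`p`-divisible in `E(K̄_v)`) gives `b ∈ ker red_v` with `p b = ι m`; `b` is `p^{k+1}`-torsion, hence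
`b = ι m'` with `m' ∈ E[p^∞](ℚ̄)` (torsion is algebraic), `m' ∈ C_v` and `p m' = m` (`ι` injective).
[cite: GreenbergLNM1716, §1 p. 62 and §2 p. 63] [cite: SilvermanAEC2009, Prop. VII.2.1 and Cor. III.6.4] -/
theorem reductionDatum_divisible (hpv : ((p : ℕ) : 𝓞 ℚ) ∈ v.asIdeal)
    (hΔ : ¬ (p : ℤ) ∣ minimalDiscriminantInt V) (hord : ¬ (p : ℤ) ∣ V.frobeniusTrace p) :
    ∀ m ∈ (reductionDatum V p hpv hΔ).plus, ∃ m' ∈ (reductionDatum V p hpv hΔ).plus, p • m' = m := by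
  -- residue characteristic `p` and the ordinary point (as in `GreenbergVatsalReductionDatumCard`)
  have hΔu := V.isUnit_Δ_localIntModel hpv (specVal_spec v) hΔ
  have hvO : (specVal v).Integers (specVal v).valuationSubring :=
    Valuation.valuationSubring.integers (specVal v)
  have hpO : specVal v ((p : ℕ) : AlgebraicClosure (v.adicCompletion ℚ)) < 1 := by
    have h := IsDedekindDomain.HeightOneSpectrum.spectralValuation_algebraMap_ringOfIntegers_lt_one
      (v := v) (specVal_spec v) hpv
    rwa [map_natCast] at h
  haveI hchar : CharP (IsLocalRing.ResidueField ↥(specVal v).valuationSubring) p := by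
    refine (CharP.charP_iff_prime_eq_zero hp.out).mpr ?_
    rw [← map_natCast (IsLocalRing.residue ↥(specVal v).valuationSubring),
      IsLocalRing.residue_eq_zero_iff, IsLocalRing.mem_maximalIdeal, mem_nonunits_iff,
      hvO.isUnit_iff_valuation_eq_one]
    exact fun h ↦ absurd h (ne_of_lt (by simpa using hpO))
  have hordA := V.exists_zsmul_eq_zero_localRed_ne_zero (specVal_spec v) hΔu (localRed V p hpv hΔ)
    (fun _ ↦ rfl) hpv hΔ hord
  obtain ⟨-, -, hdivl⟩ := V.localRed_ordinary_filtration hΔu (localRed V p hpv hΔ) (fun _ ↦ rfl)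
    hordA
  have hinj := GreenbergVatsalTateDatumCofree.pointsMap_coe_injective V p (v := v)
  intro m hm
  obtain ⟨k, hk⟩ := (AddCommGroup.mem_primaryComponent).1 m.2
  have hred := (mem_reductionDatum_plus_iff V p hpv hΔ m).1 hm
  obtain ⟨b, hbred, hpb⟩ := hdivl _ hred
  -- `b` is `p^(k+1)`-torsion
  have hbk : p ^ (k + 1) • b = 0 := by
    rw [pow_succ, mul_smul, hpb, ← map_nsmul, hk, map_zero]
  obtain ⟨m', hm'⟩ := GreenbergVatsalTateDatumCofree.exists_primaryTorsion_pointsMap_eq V p b (k + 1)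
    hbk
  refine ⟨m', ?_, ?_⟩
  · rw [mem_reductionDatum_plus_iff, hm']
    exact hbred
  · apply hinj
    change pointsMap V (v.adicCompletion ℚ) ((p • m' : V.geomPrimaryTorsion p) : V.geomPoints) =
      pointsMap V (v.adicCompletion ℚ) (m : V.geomPoints)
    rw [AddSubmonoidClass.coe_nsmul, map_nsmul, hm', hpb]

/-- **`C_v ≠ E[p^∞]` at a good ordinary prime** (the quotient `Ẽ[p^∞] ≅ ℚ_p/ℤ_p` is non-zero,
Greenberg LNM 1716 §2 p. 63): the ordinary `p`-torsion point of `E(K̄_v)` with NON-ZERO reduction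
(`exists_zsmul_eq_zero_localRed_ne_zero`, Silverman V.3.1 / VII.2.1) is `ι m` for an
`m ∈ E[p^∞](ℚ̄) ∖ C_v`. [cite: GreenbergLNM1716, §2 p. 63] [cite: SilvermanAEC2009, Thm. V.3.1(a) and Prop. VII.2.1] -/
theorem reductionDatum_plus_ne_top (hpv : ((p : ℕ) : 𝓞 ℚ) ∈ v.asIdeal)
    (hΔ : ¬ (p : ℤ) ∣ minimalDiscriminantInt V) (hord : ¬ (p : ℤ) ∣ V.frobeniusTrace p) :
    (reductionDatum V p hpv hΔ).plus ≠ ⊤ := by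
  have hΔu := V.isUnit_Δ_localIntModel hpv (specVal_spec v) hΔ
  obtain ⟨P, hpP, hP⟩ := V.exists_zsmul_eq_zero_localRed_ne_zero (specVal_spec v) hΔu
    (localRed V p hpv hΔ) (fun _ ↦ rfl) hpv hΔ hord
  obtain ⟨m, hm⟩ := GreenbergVatsalTateDatumCofree.exists_primaryTorsion_pointsMap_eq V p P 1
    (by rw [pow_one, ← natCast_zsmul]; exact hpP)
  intro htop
  apply hP
  have hmC : m ∈ (reductionDatum V p hpv hΔ).plus := by
    rw [htop]; exact AddSubgroup.mem_top m
  rw [mem_reductionDatum_plus_iff, hm] at hmC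
  exact hmC

/-- **`C_v ≠ 0` at a good ordinary prime**: `#(C_v ∩ E[p^∞][p]) = p`
(`natCard_reductionDatum_plus_inf_torsionBy`, Greenberg's `ℱ[p^∞] ≅ ℚ_p/ℤ_p` at level `p`), while
`#(0 ∩ E[p^∞][p]) = 1`. [cite: GreenbergLNM1716, §1 p. 62 and §2 p. 70] [cite: GreenbergVatsal2000, §2 p. 14] -/
theorem reductionDatum_plus_ne_bot (hpv : ((p : ℕ) : 𝓞 ℚ) ∈ v.asIdeal)
    (hΔ : ¬ (p : ℤ) ∣ minimalDiscriminantInt V) (hord : ¬ (p : ℤ) ∣ V.frobeniusTrace p) :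
    (reductionDatum V p hpv hΔ).plus ≠ ⊥ := by
  intro hbot
  have h := natCard_reductionDatum_plus_inf_torsionBy V p hpv hΔ hord
  rw [hbot, bot_inf_eq, AddSubgroup.card_bot] at h
  exact hp.out.one_lt.ne h

end Datum

/-! ### §2 The ramified-`χ` inertia witness: `σ ∈ I_v` with `σ√d = −√d` when `ord_v d = 1` -/

section Witness

variable (p : ℕ) [hp : Fact p.Prime] {v : HeightOneSpectrum (𝓞 ℚ)}

/-- **`ord_v(p*) = 1`** at the place `v ∋ p`, `p* = (−1)^{⌊p/2⌋} p` (`v = (p)` in `𝓞 ℚ = ℤ`,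
`Rat.asIdeal_eq_span_of_prime_mem`; `−1` is a unit). [folklore] -/
theorem intValuation_pStar (hpv : ((p : ℕ) : 𝓞 ℚ) ∈ v.asIdeal) :
    v.intValuation (((-1 : ℤ) ^ (p / 2) * p : ℤ) : 𝓞 ℚ) = WithZero.exp (-1 : ℤ) := by
  have hp0 : ((p : ℕ) : 𝓞 ℚ) ≠ 0 := by exact_mod_cast hp.out.ne_zero
  rw [Int.cast_mul, Int.cast_pow, Int.cast_neg, Int.cast_one, Int.cast_natCast, map_mul, map_pow,
    Valuation.map_neg, map_one, one_pow, one_mul]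
  exact intValuation_singleton v hp0 (Rat.asIdeal_eq_span_of_prime_mem v hp.out hpv)

/-- **A LOCAL inertia element moving `√d`** for `d ∈ ℤ` with `ord_v d = 1` at a place `v ∋ p`, `p`
ODD: some `σ` in the inertia group of `ℚ̄_v/ℚ_v` has `res(σ)•√d = −√d` in `ℚ̄`. The tree's Kummer
element (`exists_mem_inertia_smul_geomSqrt_eq_neg`: the Kummer character of a `v`-uniformizer is onto
`μ₂` on the inertia group of a prime `𝔓 ∣ v` of `\bar ℤ`; Lang *FDG* Ch. 6 Prop. 1.3) at the prime
`𝔓₀` cut out by the chosen `ℚ̄ → ℚ̄_v`, whose inertia group IS the image of the local one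
(`inertia_adicCompletionPrime_eq_map_absInertia`). This is "`χ_d` is RAMIFIED at `v`".
[cite: Lang1983, Ch. 6 Prop. 1.3] -/
theorem exists_mem_absInertia_smul_geomSqrt_eq_neg (hp2 : p ≠ 2) (hpv : ((p : ℕ) : 𝓞 ℚ) ∈ v.asIdeal)
    {d : ℤ} (hd : v.intValuation (d : 𝓞 ℚ) = WithZero.exp (-1 : ℤ)) :
    ∃ σ ∈ absInertia (v.adicCompletion ℚ),
      absGaloisRestrict ℚ (v.adicCompletion ℚ) σ • geomSqrt (d : ℚ) = -geomSqrt (d : ℚ) := by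
  have h2 : (2 : 𝓞 ℚ) ∉ v.asIdeal := two_not_mem_of_natCast_prime_mem hp.out hp2 hpv
  obtain ⟨σ, hσI, hσ⟩ := exists_mem_inertia_smul_geomSqrt_eq_neg hd h2
    (adicCompletionPrime_mem_primesAbove ℚ v)
  have hcoe : (((d : 𝓞 ℚ) : 𝓞 ℚ) : ℚ) = (d : ℚ) := by
    rw [RingOfIntegers.coe_eq_algebraMap, map_intCast]
  rw [hcoe] at hσ
  rw [inertia_adicCompletionPrime_eq_map_absInertia] at hσI
  obtain ⟨τ, hτ, rfl⟩ := Subgroup.mem_map.1 hσI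
  exact ⟨τ, hτ, hσ⟩

/-- The witness for `d = p*`: an inertia element at `v ∋ p` (`p` odd) with `res(σ)•√p* = −√p*`.
[cite: Lang1983, Ch. 6 Prop. 1.3] -/
theorem exists_mem_absInertia_smul_geomSqrt_pStar_eq_neg (hp2 : p ≠ 2)
    (hpv : ((p : ℕ) : 𝓞 ℚ) ∈ v.asIdeal) :
    ∃ σ ∈ absInertia (v.adicCompletion ℚ),
      absGaloisRestrict ℚ (v.adicCompletion ℚ) σ • geomSqrt ((-1 : ℚ) ^ (p / 2) * p) =
        -geomSqrt ((-1 : ℚ) ^ (p / 2) * p) := by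
  have h := exists_mem_absInertia_smul_geomSqrt_eq_neg p hp2 hpv (intValuation_pStar p hpv)
  push_cast at h
  exact h

end Witness

/-! ### §3 Assembly: the ramified ordinary line of a good-ordinary twist model -/

section Assembly

variable (p : ℕ) [hp : Fact p.Prime] {v : HeightOneSpectrum (𝓞 ℚ)}

/-- **EXPLICIT FORM — a transport of Greenberg's datum IS a ramified ordinary line.** `V/ℚ`
globally minimal, good ORDINARY at the odd `p` (`p ∤ Δ_V`, `p ∤ a_p(V)`), `v ∋ p`, `d ∈ ℤ` with
`ord_v d = 1`, `W` ANY Weierstrass curve over `ℚ`, `e : V[p^∞] ≃+ W[p^∞]` additive, sign-equivariant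
at every `σ ∈ Γ_ℚ` and ANTI-equivariant wherever `σ√d = −√d` (e.g. the twisting isomorphism of a
`ℚ`-model `W = C • V^{(d)}`, FILE A `exists_addEquiv_geomPrimaryTorsion_of_model_twist_sign`), and `L`
a local datum of `W` at `v` with `m ∈ L.plus ↔ e⁻¹ m ∈ C_v(V)` (it exists: FILE A
`exists_localDatum_transport`): then `IsRamifiedOrdinaryLine W p L`. This is EPW §3.1's
`A'_{f̃,a} = t(C_v(V))`, `a = (p−1)/2`, with Greenberg LNM 1716 p. 63 (the line and its unramified
quotient) and p. 69 (inertia on `C_v`), twisted by the ramified `χ_d`.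
[cite: EmertonPollackWeston2006, §3.1 (eq:ordes) (arXiv:math/0404484 p. 17)]
[cite: GreenbergLNM1716, §2 pp. 62–63 and p. 69] [cite: SilvermanAEC2009, X.5 Cor. 5.4] -/
theorem isRamifiedOrdinaryLine_of_transport_reductionDatum (hp2 : p ≠ 2)
    (V : WeierstrassCurve ℚ) [V.IsElliptic] [V.IsGloballyMinimal]
    (hpv : ((p : ℕ) : 𝓞 ℚ) ∈ v.asIdeal) (hΔ : ¬ (p : ℤ) ∣ minimalDiscriminantInt V)
    (hord : ¬ (p : ℤ) ∣ V.frobeniusTrace p)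
    {d : ℤ} (hd : v.intValuation (d : 𝓞 ℚ) = WithZero.exp (-1 : ℤ))
    {W : WeierstrassCurve ℚ} (e : ↥(V.geomPrimaryTorsion p) ≃+ ↥(W.geomPrimaryTorsion p))
    (he : ∀ σ : absoluteGaloisGroup ℚ, (∀ m, e (σ • m) = σ • e m) ∨ (∀ m, e (σ • m) = -(σ • e m)))
    (heneg : ∀ σ : absoluteGaloisGroup ℚ, σ • geomSqrt (d : ℚ) = -geomSqrt (d : ℚ) →
      ∀ m, e (σ • m) = -(σ • e m))
    (L : LocalDatum ℚ ↥(W.geomPrimaryTorsion p) v)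
    (hL : ∀ m, m ∈ L.plus ↔ e.symm m ∈ (reductionDatum V p hpv hΔ).plus) :
    IsRamifiedOrdinaryLine W p L := by
  obtain ⟨σ₀, hσ₀, hσneg⟩ := exists_mem_absInertia_smul_geomSqrt_eq_neg p hp2 hpv hd
  exact isRamifiedOrdinaryLine_of_transport hp2 (reductionDatum V p hpv hΔ) e he L hL
    (reductionDatum_divisible V p hpv hΔ hord) (reductionDatum_plus_ne_top V p hpv hΔ hord)
    (reductionDatum_plus_ne_bot V p hpv hΔ hord) (reductionDatum_htriv V p hpv hΔ)
    ⟨σ₀, hσ₀, heneg _ hσneg⟩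

/-- **A RAMIFIED ORDINARY LINE EXISTS on every `ℚ`-model of a quadratic twist, ramified at `p`, of a
good-ordinary curve.** `V/ℚ` globally minimal, `p` odd, `p ∤ Δ_V`, `p ∤ a_p(V)`, `v ∋ p`, `d ∈ ℤ` with
`ord_v d = 1`, `W = C • V^{(d)}` over `ℚ`: `∃ L, IsRamifiedOrdinaryLine W p L` — namely `t(C_v(V))`
for the twisting isomorphism `t` (FILE A). [cite: EmertonPollackWeston2006, §3.1 (eq:ordes) (arXiv:math/0404484 p. 17)]
[cite: GreenbergLNM1716, §2 pp. 62–63 and p. 69] [cite: SilvermanAEC2009, X.5 Cor. 5.4] -/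
theorem exists_isRamifiedOrdinaryLine_of_goodOrd_model_twist (hp2 : p ≠ 2)
    (V : WeierstrassCurve ℚ) [V.IsElliptic] [V.IsGloballyMinimal]
    (hpv : ((p : ℕ) : 𝓞 ℚ) ∈ v.asIdeal) (hΔ : ¬ (p : ℤ) ∣ minimalDiscriminantInt V)
    (hord : ¬ (p : ℤ) ∣ V.frobeniusTrace p)
    {d : ℤ} (hd : v.intValuation (d : 𝓞 ℚ) = WithZero.exp (-1 : ℤ))
    {W : WeierstrassCurve ℚ} (hCW : ∃ C : VariableChange ℚ, C • V.quadraticTwist (d : ℚ) = W) :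
    ∃ L : LocalDatum ℚ ↥(W.geomPrimaryTorsion p) v, IsRamifiedOrdinaryLine W p L := by
  have hd0 : (d : ℚ) ≠ 0 := by
    intro h
    have hdz : (d : 𝓞 ℚ) = 0 := by exact_mod_cast (Int.cast_eq_zero.1 h)
    rw [hdz, map_zero] at hd
    exact WithZero.zero_ne_coe hd
  haveI : NeZero (2 : ℚ) := ⟨two_ne_zero⟩
  obtain ⟨e, he, -, heneg⟩ := exists_addEquiv_geomPrimaryTorsion_of_model_twist_sign p V hd0 hCW
  obtain ⟨L, hL⟩ := exists_localDatum_transport (reductionDatum V p hpv hΔ) e he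
  exact ⟨L, isRamifiedOrdinaryLine_of_transport_reductionDatum p hp2 V hpv hΔ hord hd e he heneg L hL⟩

/-- **The `p*`-twist model form** (the cell's (S8) / Route G binders `C • V^{(p*)} = W`,
`GoodOrd V p`): `p` odd, `V` globally minimal good ordinary at `p`, `W = C • V^{(p*)}` ⟹
`∃ L, IsRamifiedOrdinaryLine W p L` at the place `v ∋ p`.
[cite: EmertonPollackWeston2006, §3.1 (eq:ordes) (arXiv:math/0404484 p. 17)]
[cite: GreenbergLNM1716, §2 pp. 62–63 and p. 69] -/
theorem exists_isRamifiedOrdinaryLine_of_goodOrd_pStar_twist (hp2 : p ≠ 2)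
    (V : WeierstrassCurve ℚ) [V.IsElliptic] [V.IsGloballyMinimal]
    {W : WeierstrassCurve ℚ}
    (hCW : ∃ C : VariableChange ℚ, C • V.quadraticTwist ((-1 : ℚ) ^ (p / 2) * p) = W)
    (hV : GoodOrd V p) (hpv : ((p : ℕ) : 𝓞 ℚ) ∈ v.asIdeal) :
    ∃ L : LocalDatum ℚ ↥(W.geomPrimaryTorsion p) v, IsRamifiedOrdinaryLine W p L := by
  have hCW' : ∃ C : VariableChange ℚ,
      C • V.quadraticTwist ((((-1 : ℤ) ^ (p / 2) * p : ℤ)) : ℚ) = W := by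
    push_cast
    exact hCW
  exact exists_isRamifiedOrdinaryLine_of_goodOrd_model_twist p hp2 V hpv
    (V.not_dvd_minimalDiscriminantInt_of_hasGoodReductionAtPrime' p hV.1) hV.2
    (intValuation_pStar p hpv) hCW'

variable {p} {W : WeierstrassCurve ℚ} [W.IsElliptic] [W.IsGloballyMinimal]

/-- **X4♯(G-ord) ∩ `I₀*`: the ramified ordinary line EXISTS (every odd `p`, `p = 3` included).** For
`W` in X4♯(G-ord) with `e_E(p) = 2` and the place `v ∋ p`: `∃ L, IsRamifiedOrdinaryLine W p L` —
Greenberg's line of the good-ordinary twist model (`ClassX4Gord.exists_goodOrd_pStar_twist_model`)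
twisted back. The per-pair binder "ramified ordinary line at `E`" of Route G FILE 4
(`ClassX4Gord.mainConjecture_of_katoHalf_of_coeffCert_of_epw`) is a theorem on the class; the
line-RESPECTING `E[p] ≅ E₁[p]` and `Σ₀` stay per pair. X4♯(G-ord) stays CONSTRUCTION-SHAPED; nothing
booked. [cite: EmertonPollackWeston2006, §3.1 (eq:ordes) (arXiv:math/0404484 p. 17)]
[cite: GreenbergLNM1716, §2 pp. 62–63 and p. 69] -/
theorem ClassX4Gord.exists_isRamifiedOrdinaryLine (hX : ClassX4Gord W p)
    (he : semistabilityIndex W p = 2) (hpv : ((p : ℕ) : 𝓞 ℚ) ∈ v.asIdeal) :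
    ∃ L : LocalDatum ℚ ↥(W.geomPrimaryTorsion p) v, IsRamifiedOrdinaryLine W p L := by
  obtain ⟨V, _, _, C, hord, hC⟩ := ClassX4Gord.exists_goodOrd_pStar_twist_model W p hX he
  exact exists_isRamifiedOrdinaryLine_of_goodOrd_pStar_twist p hX.addv.1 V ⟨C, hC⟩ hord hpv

/-- **X3♯(G-ord) ∩ `I₀*`, `p` odd: the ramified ordinary line EXISTS** (same construction on the
good-ordinary twist model `ClassX3Gord.exists_goodOrd_pStar_twist_model`). X3♯(G-ord) stays as
labelled; nothing booked. [cite: EmertonPollackWeston2006, §3.1 (eq:ordes) (arXiv:math/0404484 p. 17)]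
[cite: GreenbergLNM1716, §2 pp. 62–63 and p. 69] -/
theorem ClassX3Gord.exists_isRamifiedOrdinaryLine (hp2 : p ≠ 2) (hX : ClassX3Gord W p)
    (he : semistabilityIndex W p = 2) (hpv : ((p : ℕ) : 𝓞 ℚ) ∈ v.asIdeal) :
    ∃ L : LocalDatum ℚ ↥(W.geomPrimaryTorsion p) v, IsRamifiedOrdinaryLine W p L := by
  obtain ⟨V, _, _, C, hord, hC⟩ := ClassX3Gord.exists_goodOrd_pStar_twist_model W p hp2 hX he
  exact exists_isRamifiedOrdinaryLine_of_goodOrd_pStar_twist p hp2 V ⟨C, hC⟩ hord hpv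

end Assembly

end Summit.BirchSwinnertonDyer.Rank1Residual.Additive

end
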